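import Summits.HodgeConjecture.CorCM.GaloisDodecicOrderSixSubgroup
import Mathlib.Algebra.BigOperators.Fin
import HarnessLib

/-!
# A classification-free stabiliser lemma for a non-commutative subgroup of order `6` and index `2` with a central
# involution outside it (the `ℤ/2 × S₃` pattern of a dihedral Galois CM field of degree `12`)

COR-CM (cell `pub-hodgecm2`), binder seat b04 (gen 14), count-neutral claim GALOIS-DODECIC, part Ib; input of
`CorCM/GaloisDodecicSimpleCMSixfolds` (part II).  Sequel of `CorCM/GaloisOcticStabiliserLemma` (gen 13: subgroup of
order `4` and index `2`, balanced `(2,2)`).  KERNEL ONLY: theorems, no definition, no named fact, no `sorry`.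
`HC_CM` is not used and not claimed.

`GaloisDodecic.exists_ne_one_forall_mem_iff` — **the stabiliser lemma**.  Let `H ≤ G` be a NON-COMMUTATIVE subgroup
with `|H| = 6` of index `2`, `c ∈ Z(G)` an involution outside `H`, `T ⊆ G` with `c·g ∈ T ↔ g ∉ T` (a "CM type" on
`G = H ⊔ cH` relative to `c`), and suppose `T ∩ H` and `H ∖ T` have the same number of elements ("balanced
fibres", three each).  Then some `u ≠ 1` satisfies `w ∈ T ↔ u·w ∈ T` for all `w`.  Proof: by part Ia,
`H = {1, r, r², s, sr, sr²}` with the `S₃` relations; left multiplication by `r, s, sr, sr²` permutes the six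
elements by four explicit permutations of `Fin 6`, and the remaining combinatorial core — a `3`-subset of `Fin 6`
is either invariant under the `r`-permutation or mapped onto its complement by one of the three
involution-permutations — is decided by the kernel (`GaloisDodecic.core`).  In the first case `u = r`, in the
second `u = c·v`.  For `G = Gal(K/ℚ)` (`[K:ℚ] = 12`), `H = Gal(K/k)` (`k` imaginary quadratic) and `T` the set of
`g` with `σ_g ∈ Φ` this is the non-primitivity of a CM type with multiplicities `(3,3)` over `k`.  NEW in this
form: the print ([Dodson1984] §4 p. 18 — the partition `64 = 4 + 12 + 12 + 12 + 24` of the types of a `D₁₂` field —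
and §5.3) has "preliminary results for `n = 6`" only.
-/

set_option autoImplicit false

namespace Summit.HodgeConjecture.CorCM

namespace GaloisDodecic

section Group

variable {G : Type*} [Group G]

/-- **The combinatorial core, decided by the kernel.**  For a `0/1`-pattern on `Fin 6` with exactly three `1`s,
either the pattern is invariant under `πr = (0 1 2)(3 5 4)` (then it is `111000` or `000111`), or it is mapped onto
its complement by one of the three fixed-point-free involutions `πs = (0 3)(1 4)(2 5)`, `π4 = (0 4)(1 5)(2 3)`,
`π5 = (0 5)(1 3)(2 4)` — the permutations by which left multiplication by `r, s, sr, sr²` acts on the enumeration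
`(1, r, r², s, sr, sr²)` of a non-commutative group of order `6` (`r³ = 1`, `s² = 1`, `rs = sr²`). [folklore] -/
theorem core (b : Fin 6 → Bool)
    (h3 : (b 0).toNat + (b 1).toNat + (b 2).toNat + (b 3).toNat + (b 4).toNat + (b 5).toNat = 3) :
    (∀ i, b i = b ((![1, 2, 0, 5, 3, 4] : Fin 6 → Fin 6) i)) ∨
    (∀ i, b i = !b ((![3, 4, 5, 0, 1, 2] : Fin 6 → Fin 6) i)) ∨
    (∀ i, b i = !b ((![4, 5, 3, 2, 0, 1] : Fin 6 → Fin 6) i)) ∨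
    (∀ i, b i = !b ((![5, 3, 4, 1, 2, 0] : Fin 6 → Fin 6) i)) := by
  revert h3 b
  decide

/-- `(decide p).toNat` is the indicator `[p]`. [folklore] -/
private theorem toNat_decide (p : Prop) [Decidable p] : (decide p).toNat = if p then 1 else 0 := by
  by_cases hp : p <;> simp [hp]

/-- Equal decisions mean equivalent propositions. [folklore] -/
private theorem iff_of_decide_eq {p q : Prop} [Decidable p] [Decidable q] (h : decide p = decide q) : p ↔ q := by
  by_cases hp : p <;> by_cases hq : q <;> simp_all

/-- Opposite decisions mean `p ↔ ¬ q`. [folklore] -/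
private theorem iff_not_of_decide_eq_not {p q : Prop} [Decidable p] [Decidable q] (h : decide p = !decide q) :
    p ↔ ¬ q := by
  by_cases hp : p <;> by_cases hq : q <;> simp_all

/-- **The stabiliser lemma.**  Let `H ≤ G` be a non-commutative subgroup of order `6` and index `2`, let
`c ∈ Z(G)` be an involution outside `H`, let `T ⊆ G` satisfy `c g ∈ T ↔ g ∉ T`, and suppose `T` meets `H` in as
many elements as it misses (three each).  Then there is `u ≠ 1` with `w ∈ T ↔ u w ∈ T` for every `w ∈ G`.  With
`H = {1, r, r², s, sr, sr²}` (`r³ = 1`, `s² = 1`, `rs = sr²`, part Ia): if `T ∩ H ∈ {{1, r, r²}, {s, sr, sr²}}`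
take `u = r`; otherwise `T ∩ H` is a transversal of the pairing `h ↔ v h` for one involution `v ∈ {s, sr, sr²}`
and `u = c v` works.  NEW in this form (the print, [Dodson1984] §4–§5.3, has "preliminary results for `n = 6`"
only). -/
theorem exists_ne_one_forall_mem_iff (H : Subgroup G) (hH : Nat.card H = 6) (hidx : H.index = 2)
    (hnc : ∃ a ∈ H, ∃ b ∈ H, a * b ≠ b * a)
    {c : G} (hc : c * c = 1) (hcH : c ∉ H) (hcomm : ∀ g : G, c * g = g * c)
    {T : Set G} (hT : ∀ g : G, c * g ∈ T ↔ g ∉ T)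
    (hbal : {g : G | g ∈ H ∧ g ∈ T}.ncard = {g : G | g ∈ H ∧ g ∉ T}.ncard) :
    ∃ u : G, u ≠ 1 ∧ ∀ w : G, w ∈ T ↔ u * w ∈ T := by
  classical
  -- every element off `H` is `c * h`
  have hoff : ∀ z : G, z ∉ H → ∃ h ∈ H, z = c * h := by
    intro z hz
    refine ⟨c * z, ?_, by rw [← mul_assoc, hc, one_mul]⟩
    rw [Subgroup.mul_mem_iff_of_index_two hidx]
    exact ⟨fun h => absurd h hcH, fun h => absurd h hz⟩
  -- (1)–(5) the `S₃` structure of `H` (part Ia)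
  obtain ⟨r, s, hr1, hr3, hss, hrs, heH, hinj, hcover⟩ := exists_generators_of_card_six hH hnc
  set e : Fin 6 → G := ![1, r, r * r, s, s * r, s * (r * r)] with he_def
  have hr3' : ∀ x : G, r * (r * (r * x)) = x := fun x => by
    rw [← mul_assoc, ← mul_assoc, mul_assoc r r r, hr3, one_mul]
  have hrs' : ∀ x : G, r * (s * x) = s * (r * (r * x)) := fun x => by
    rw [← mul_assoc, hrs, mul_assoc, mul_assoc]
  have hss' : ∀ x : G, s * (s * x) = x := fun x => by rw [← mul_assoc, hss, one_mul]
  have hHn : (H : Set G).ncard = 6 := by rw [← hH]; exact (Nat.card_coe_set_eq (H : Set G)).symm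
  have hHfin : (H : Set G).Finite := Set.finite_of_ncard_pos (by rw [hHn]; norm_num)
  have hrH : r ∈ H := heH 1
  have hsH' : s ∈ H := heH 3
  -- (6) the left-multiplication tables of `r, s, sr, sr²` on `e`
  have htab_r : ∀ i, r * e i = e ((![1, 2, 0, 5, 3, 4] : Fin 6 → Fin 6) i) := by
    intro i
    fin_cases i <;> simp only [he_def, Fin.zero_eta, Fin.mk_one, Fin.reduceFinMk, Fin.isValue, Matrix.cons_val,
      mul_one, hrs', hrs, hr3]
  have htab_s : ∀ i, s * e i = e ((![3, 4, 5, 0, 1, 2] : Fin 6 → Fin 6) i) := by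
    intro i
    fin_cases i <;> simp only [he_def, Fin.zero_eta, Fin.mk_one, Fin.reduceFinMk, Fin.isValue, Matrix.cons_val,
      mul_one, hss', hss]
  have htab_4 : ∀ i, s * r * e i = e ((![4, 5, 3, 2, 0, 1] : Fin 6 → Fin 6) i) := by
    intro i
    fin_cases i <;> simp only [he_def, Fin.zero_eta, Fin.mk_one, Fin.reduceFinMk, Fin.isValue, Matrix.cons_val,
      mul_assoc, mul_one, hrs', hss', hrs, hr3, hss]
  have htab_5 : ∀ i, s * (r * r) * e i = e ((![5, 3, 4, 1, 2, 0] : Fin 6 → Fin 6) i) := by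
    intro i
    fin_cases i <;> simp only [he_def, Fin.zero_eta, Fin.mk_one, Fin.reduceFinMk, Fin.isValue, Matrix.cons_val,
      mul_assoc, mul_one, hrs', hss', hrs, hr3, hss]
  -- (7) the two ways to finish
  have R1 : ∀ (v : G) (π : Fin 6 → Fin 6), v ≠ 1 → (∀ i, v * e i = e (π i)) →
      (∀ i, e i ∈ T ↔ e (π i) ∈ T) → ∃ u : G, u ≠ 1 ∧ ∀ w : G, w ∈ T ↔ u * w ∈ T := by
    intro v π hv1 htab hb
    refine ⟨v, hv1, fun w => ?_⟩
    by_cases hw : w ∈ H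
    · obtain ⟨i, rfl⟩ := hcover w hw
      rw [htab i]
      exact hb i
    · obtain ⟨h, hh, rfl⟩ := hoff w hw
      obtain ⟨i, rfl⟩ := hcover h hh
      rw [← mul_assoc, ← hcomm v, mul_assoc, htab i, hT, hT]
      exact not_congr (hb i)
  have R2 : ∀ (v : G) (π : Fin 6 → Fin 6), v ∈ H → (∀ i, v * e i = e (π i)) →
      (∀ i, e i ∈ T ↔ e (π i) ∉ T) → ∃ u : G, u ≠ 1 ∧ ∀ w : G, w ∈ T ↔ u * w ∈ T := by
    intro v π hvH htab hb
    have hcv : c * v ∉ H := by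
      rw [Subgroup.mul_mem_iff_of_index_two hidx]
      exact fun h => hcH (h.2 hvH)
    refine ⟨c * v, fun h => hcv (h ▸ H.one_mem), fun w => ?_⟩
    by_cases hw : w ∈ H
    · obtain ⟨i, rfl⟩ := hcover w hw
      rw [mul_assoc, htab i, hT]
      exact hb i
    · obtain ⟨h, hh, rfl⟩ := hoff w hw
      obtain ⟨i, rfl⟩ := hcover h hh
      have : c * v * (c * e i) = e (π i) := by
        rw [mul_assoc, ← mul_assoc v c, ← hcomm v, mul_assoc c v, ← mul_assoc c c, hc, one_mul, htab i]
      rw [this, hT]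
      constructor
      · intro h1
        by_contra h2
        exact h1 ((hb i).2 h2)
      · intro h1 h2
        exact (hb i).1 h2 h1
  -- (8) `|T ∩ H| = 3`, read on `Fin 6`
  have hunion : {g : G | g ∈ H ∧ g ∈ T} ∪ {g : G | g ∈ H ∧ g ∉ T} = (H : Set G) := by
    ext g
    simp only [Set.mem_union, Set.mem_setOf_eq, SetLike.mem_coe]
    tauto
  have hdisj : Disjoint {g : G | g ∈ H ∧ g ∈ T} {g : G | g ∈ H ∧ g ∉ T} := by
    rw [Set.disjoint_left]
    rintro g ⟨-, hg1⟩ ⟨-, hg2⟩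
    exact hg2 hg1
  have hsum := Set.ncard_union_eq hdisj (hHfin.subset (by rw [← hunion]; exact Set.subset_union_left))
    (hHfin.subset (by rw [← hunion]; exact Set.subset_union_right))
  rw [hunion, hHn, ← hbal] at hsum
  have hthree : {g : G | g ∈ H ∧ g ∈ T}.ncard = 3 := by omega
  have hset : {g : G | g ∈ H ∧ g ∈ T} = e '' {i : Fin 6 | e i ∈ T} := by
    ext g
    constructor
    · rintro ⟨hgH, hgT⟩
      obtain ⟨i, rfl⟩ := hcover g hgH
      exact ⟨i, hgT, rfl⟩
    · rintro ⟨i, hi, rfl⟩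
      exact ⟨heH i, hi⟩
  rw [hset, Set.ncard_image_of_injective _ hinj] at hthree
  have hfin : {i : Fin 6 | e i ∈ T} = ↑(Finset.univ.filter fun i : Fin 6 => e i ∈ T) := by
    ext i
    simp
  rw [hfin, Set.ncard_coe_finset, Finset.card_filter, Fin.sum_univ_six] at hthree
  -- (9) the decided core and the assembly
  rw [← toNat_decide (e 0 ∈ T), ← toNat_decide (e 1 ∈ T), ← toNat_decide (e 2 ∈ T), ← toNat_decide (e 3 ∈ T),
    ← toNat_decide (e 4 ∈ T), ← toNat_decide (e 5 ∈ T)] at hthree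
  have hcore := core (fun i => decide (e i ∈ T)) hthree
  rcases hcore with hb | hb | hb | hb
  · exact R1 r _ hr1 htab_r fun i => iff_of_decide_eq (hb i)
  · exact R2 s _ hsH' htab_s fun i => iff_not_of_decide_eq_not (hb i)
  · exact R2 (s * r) _ (H.mul_mem hsH' hrH) htab_4 fun i => iff_not_of_decide_eq_not (hb i)
  · exact R2 (s * (r * r)) _ (H.mul_mem hsH' (H.mul_mem hrH hrH)) htab_5 fun i =>
      iff_not_of_decide_eq_not (hb i)

end Group

end GaloisDodecic

end Summit.HodgeConjecture.CorCM
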